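import Summits.SmoothPoincare4.SmoothPoincare4.Theorems.SymplecticOrigamiGromovRecognitionRelEndWindLinAlg
import Literature.Topology.PlaneTopology.WindingNumber
import Mathlib.Analysis.Calculus.FDeriv.Basic
import Mathlib.Analysis.Normed.Module.FiniteDimension
import Mathlib.Analysis.Complex.Basic
import Mathlib.LinearAlgebra.Determinant
import Mathlib.Algebra.Module.Equiv.Basic

/-!
# The local index of a planar map at a non-degenerate zero
(registered helper `helper_windAtSimpleZero` of the stub `stub_normalWitnessTransfer`, line
`cross-cap-laurent`, crux `GromovRecognitionRelEnd`, item stmt-SmoothPoincare4-11009)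

Claim (`helper_windAtSimpleZero`): let `f : ℂ → ℂ` be continuous on the ball `B(z₀, ρ)`,
differentiable at `z₀` with real-linear derivative `L`, `f z₀ = 0` and `det L ≠ 0`.  Then for some
`0 < r₀ < ρ` the point `z₀` is the only zero of `f` in `dist z z₀ ≤ r₀`, and along every circle
`circleLoop z₀ r` (`0 < r ≤ r₀`) the loop `f ∘ circleLoop z₀ r` avoids `0` and winds `+1` if
`det L > 0`, `-1` if `det L < 0` (J. Milnor, *Topology from the Differentiable Viewpoint* (1965),
§6 Lemma 4: the index at a non-degenerate zero is the sign of the Jacobian determinant).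

Proof, in the language of `Literature/Topology/PlaneTopology/WindingNumber.lean`:
* `HelperWindAtSimpleZero.exists_mul_norm_le_of_det_ne_zero` — `det L ≠ 0` makes `L` a unit
  (`LinearMap.isUnit_iff_isUnit_det`), hence injective and bounded below on the
  finite-dimensional `ℂ`: `c ‖v‖ ≤ ‖L v‖` with `c > 0` (`LinearMap.exists_antilipschitzWith`).
* First-order Taylor bound (`HasFDerivAt.isLittleO`): `‖f z - L (z - z₀)‖ ≤ (c/2) ‖z - z₀‖` for
  `dist z z₀ < ε`; with `r₀ := min (ε/2) (ρ/2)` this gives `(c/2) ‖z - z₀‖ ≤ ‖f z‖` on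
  `dist z z₀ ≤ r₀` (isolation of the zero, non-vanishing of the loops), and Rouché's principle for
  loops (`wind_eq_of_norm_sub_lt`) against the linear loop `t ↦ L (circleLoop 0 r t)`
  (`circleLoop z₀ r t - z₀ = circleLoop 0 r t`, `circleLoop_sub`) identifies the winding numbers.
* `HelperWindAtSimpleZero.wind_linear_circleLoop` — the linear loop winds `+1` when `det L > 0`
  (`helper_wind_comp_posDet`, `wind_circleLoop_zero`), and `-1` when `det L < 0`: then
  `L = conj ∘ L'` with `det L' = - det L > 0` (`HelperWindAtSimpleZero.det_conj_comp`, read off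
  `det_realLinear_complex_eq`), and conjugation reverses winding numbers (`helper_wind_conj`).

References: J. W. Milnor, *Topology from the Differentiable Viewpoint*, Univ. Press of Virginia
(1965), §6 Lemma 4 [MilnorTDV1965].  No new definitions.
-/

noncomputable section

open Set Function Filter Metric Literature.Topology.PlaneTopology
open ComplexConjugate
open scoped Topology

-- the prescribed namespace `Summit.<P>.<Sub>.…` duplicates `SmoothPoincare4` (P = Sub)
set_option linter.dupNamespace false

namespace Summit.SmoothPoincare4.SmoothPoincare4.Theorems.GromovRecognitionRelEnd.CrossCapLaurent

namespace HelperWindAtSimpleZero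

/-- A real-linear self-map of `ℂ` with non-zero determinant is injective. [folklore] -/
theorem injective_of_det_ne_zero (L : ℂ →L[ℝ] ℂ) (h : LinearMap.det (L : ℂ →ₗ[ℝ] ℂ) ≠ 0) :
    Injective L := by
  have hb : Bijective (L : ℂ →ₗ[ℝ] ℂ) :=
    (Module.End.isUnit_iff _).1 ((LinearMap.isUnit_iff_isUnit_det (L : ℂ →ₗ[ℝ] ℂ)).2 h.isUnit)
  exact hb.1

/-- A real-linear self-map of `ℂ` with non-zero determinant is bounded below:
`c ‖v‖ ≤ ‖L v‖` for some `c > 0`. [folklore] -/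
theorem exists_mul_norm_le_of_det_ne_zero (L : ℂ →L[ℝ] ℂ)
    (h : LinearMap.det (L : ℂ →ₗ[ℝ] ℂ) ≠ 0) : ∃ c : ℝ, 0 < c ∧ ∀ v : ℂ, c * ‖v‖ ≤ ‖L v‖ := by
  have hinj : Injective (L : ℂ →ₗ[ℝ] ℂ) := injective_of_det_ne_zero L h
  obtain ⟨K, -, hK⟩ := (L : ℂ →ₗ[ℝ] ℂ).exists_antilipschitzWith (LinearMap.ker_eq_bot.2 hinj)
  obtain ⟨c, hc, hcL⟩ := antilipschitzWith_iff_exists_mul_le_norm.1 ⟨K, hK⟩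
  exact ⟨c, hc, fun v => hcL v⟩

/-- Post-composition with complex conjugation changes the sign of the (real) determinant of a
real-linear self-map of `ℂ`: `det (conj ∘ L) = - det L`. [folklore] -/
theorem det_conj_comp (L : ℂ →L[ℝ] ℂ) :
    LinearMap.det (((Complex.conjCLE : ℂ ≃L[ℝ] ℂ).toContinuousLinearMap.comp L : ℂ →L[ℝ] ℂ) :
      ℂ →ₗ[ℝ] ℂ) = -LinearMap.det (L : ℂ →ₗ[ℝ] ℂ) := by
  rw [det_realLinear_complex_eq, det_realLinear_complex_eq]
  simp only [ContinuousLinearMap.coe_coe, ContinuousLinearMap.coe_comp, comp_apply,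
    ContinuousLinearEquiv.coe_coe, Complex.conjCLE_apply, Complex.conj_re, Complex.conj_im]
  ring

/-- A real-linear injection of `ℂ` maps loops avoiding `0` to loops avoiding `0`. [folklore] -/
theorem isNonvanishingLoop_comp {M : ℂ →L[ℝ] ℂ} (hM : Injective M) {γ : ℝ → ℂ}
    (hγ : IsNonvanishingLoop γ) : IsNonvanishingLoop fun t => M (γ t) :=
  ⟨M.continuous.comp_continuousOn hγ.continuousOn,
    fun t ht => (map_ne_zero_iff M hM).2 (hγ.ne_zero t ht), by
      show M (γ 0) = M (γ 1)
      rw [hγ.eq_endpoints]⟩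

/-- **Winding number of a linear loop.** For a real-linear automorphism `L` of `ℂ` and `r > 0`
the loop `t ↦ L (r e^{2πit})` avoids `0` and winds `+1` about `0` if `det L > 0`, `-1` if
`det L < 0`. [folklore] -/
theorem wind_linear_circleLoop (L : ℂ →L[ℝ] ℂ) (h : LinearMap.det (L : ℂ →ₗ[ℝ] ℂ) ≠ 0) {r : ℝ}
    (hr : 0 < r) :
    IsNonvanishingLoop (fun t => L (circleLoop 0 r t)) ∧
      wind (fun t => L (circleLoop 0 r t)) =
        (if 0 < LinearMap.det (L : ℂ →ₗ[ℝ] ℂ) then 1 else -1) := by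
  have hγ : IsNonvanishingLoop (circleLoop 0 r) :=
    isNonvanishingLoop_circleLoop (by simp [abs_of_pos hr, hr.ne])
  have hinj : Injective L := injective_of_det_ne_zero L h
  refine ⟨isNonvanishingLoop_comp hinj hγ, ?_⟩
  split_ifs with hdet
  · rw [helper_wind_comp_posDet L _ hγ hdet, wind_circleLoop_zero hr]
  · have hneg : LinearMap.det (L : ℂ →ₗ[ℝ] ℂ) < 0 := lt_of_le_of_ne (not_lt.1 hdet) h
    set L' : ℂ →L[ℝ] ℂ := (Complex.conjCLE : ℂ ≃L[ℝ] ℂ).toContinuousLinearMap.comp L with hL'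
    have hdet' : 0 < LinearMap.det (L' : ℂ →ₗ[ℝ] ℂ) := by
      rw [hL', det_conj_comp]
      linarith
    have hinj' : Injective L' := Complex.conjCLE.injective.comp hinj
    have heq : (fun t => L (circleLoop 0 r t)) = fun t => conj (L' (circleLoop 0 r t)) := by
      funext t
      show L _ = conj (conj (L _))
      rw [Complex.conj_conj]
    rw [heq, helper_wind_conj _ (isNonvanishingLoop_comp hinj' hγ),
      helper_wind_comp_posDet L' _ hγ hdet', wind_circleLoop_zero hr]

end HelperWindAtSimpleZero

open HelperWindAtSimpleZero in
/-- **The local index at a non-degenerate zero is the sign of the Jacobian.** If `f : ℂ → ℂ` is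
continuous on `B(z₀, ρ)`, differentiable at `z₀` with real-linear derivative `L`, `f z₀ = 0` and
`det L ≠ 0`, then for some `0 < r₀ < ρ`: `f` has no zero with `0 < dist z z₀ ≤ r₀`, and for every
`0 < r ≤ r₀` the loop `f ∘ circleLoop z₀ r` avoids `0` and winds `+1` (`det L > 0`) or `-1`
(`det L < 0`) about `0`. [cite: MilnorTDV1965, §6 Lemma 4] -/
theorem helper_windAtSimpleZero : ∀ (f : ℂ → ℂ) (L : ℂ →L[ℝ] ℂ) (z₀ : ℂ) (ρ : ℝ), 0 < ρ → ContinuousOn f (Metric.ball z₀ ρ) → HasFDerivAt f L z₀ → f z₀ = 0 → LinearMap.det (L : ℂ →ₗ[ℝ] ℂ) ≠ 0 → ∃ r₀ : ℝ, 0 < r₀ ∧ r₀ < ρ ∧ (∀ z : ℂ, 0 < dist z z₀ → dist z z₀ ≤ r₀ → f z ≠ 0) ∧ ∀ r : ℝ, 0 < r → r ≤ r₀ → Literature.Topology.PlaneTopology.IsNonvanishingLoop (fun t => f (Literature.Topology.PlaneTopology.circleLoop z₀ r t)) ∧ Literature.Topology.PlaneTopology.wind (fun t => f (Literature.Topology.PlaneTopology.circleLoop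 z₀ r t)) = (if 0 < LinearMap.det (L : ℂ →ₗ[ℝ] ℂ) then 1 else -1) := by
  intro f L z₀ ρ hρ hfc hfd hf0 hdet
  obtain ⟨c, hc, hcL⟩ := exists_mul_norm_le_of_det_ne_zero L hdet
  -- first-order Taylor bound `‖f z - L (z - z₀)‖ ≤ (c/2) ‖z - z₀‖` near `z₀`
  have hev : ∀ᶠ z in 𝓝 z₀, ‖f z - L (z - z₀)‖ ≤ c / 2 * ‖z - z₀‖ := by
    have h := hfd.isLittleO.def (half_pos hc)
    simpa only [hf0, sub_zero] using h
  obtain ⟨ε, hε, hεb⟩ := Metric.eventually_nhds_iff.1 hev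
  set r₀ : ℝ := min (ε / 2) (ρ / 2) with hr₀
  have hr₀pos : 0 < r₀ := lt_min (half_pos hε) (half_pos hρ)
  have hr₀ε : r₀ < ε := (min_le_left _ _).trans_lt (half_lt_self hε)
  have hr₀ρ : r₀ < ρ := (min_le_right _ _).trans_lt (half_lt_self hρ)
  -- the lower bound `(c/2) ‖z - z₀‖ ≤ ‖f z‖` on `dist z z₀ ≤ r₀`
  have happ : ∀ z : ℂ, dist z z₀ ≤ r₀ → ‖f z - L (z - z₀)‖ ≤ c / 2 * ‖z - z₀‖ := fun z hz =>
    hεb (hz.trans_lt hr₀ε)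
  have hlow : ∀ z : ℂ, dist z z₀ ≤ r₀ → c / 2 * ‖z - z₀‖ ≤ ‖f z‖ := by
    intro z hz
    have h1 := happ z hz
    have h2 := hcL (z - z₀)
    have h3 := norm_sub_norm_le (L (z - z₀)) (f z)
    rw [← norm_sub_rev (f z)] at h3
    linarith
  refine ⟨r₀, hr₀pos, hr₀ρ, fun z hz0 hz h0 => ?_, fun r hr hrr₀ => ?_⟩
  · -- isolation of the zero
    have h := hlow z hz
    rw [h0, norm_zero, ← dist_eq_norm] at h
    nlinarith
  · -- the circle of radius `r` about `z₀`
    have hdist : ∀ t, dist (circleLoop z₀ r t) z₀ = r := fun t => by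
      rw [dist_eq_norm, norm_circleLoop_sub_center, abs_of_pos hr]
    have hsub : ∀ t, circleLoop z₀ r t - z₀ = circleLoop 0 r t := fun t => by
      rw [circleLoop_sub, sub_self]
    have hcont : ContinuousOn (fun t => f (circleLoop z₀ r t)) (Icc 0 1) :=
      (hfc.comp_continuous (continuous_circleLoop z₀ r) fun t =>
        mem_ball.2 ((hdist t).trans_lt (hrr₀.trans_lt hr₀ρ))).continuousOn
    have hne : ∀ t, f (circleLoop z₀ r t) ≠ 0 := fun t h0 => by
      have h := hlow _ ((hdist t).le.trans hrr₀)
      rw [h0, norm_zero, ← dist_eq_norm, hdist] at h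
      nlinarith
    have h01 : (fun t => f (circleLoop z₀ r t)) 0 = (fun t => f (circleLoop z₀ r t)) 1 := by
      show f (circleLoop z₀ r 0) = f (circleLoop z₀ r 1)
      rw [circleLoop_zero_eq]
    obtain ⟨hLγ, hwind⟩ := wind_linear_circleLoop L hdet hr
    refine ⟨⟨hcont, fun t _ => hne t, h01⟩, ?_⟩
    rw [← hwind]
    refine wind_eq_of_norm_sub_lt hcont h01 hLγ fun t _ => ?_
    have h1 := happ _ ((hdist t).le.trans hrr₀)
    have h2 := hcL (circleLoop z₀ r t - z₀)
    rw [hsub] at h1 h2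
    have hnorm : ‖circleLoop 0 r t‖ = r := by
      simpa [abs_of_pos hr] using norm_circleLoop_sub_center 0 r t
    rw [hnorm] at h1 h2
    calc ‖f (circleLoop z₀ r t) - L (circleLoop 0 r t)‖ ≤ c / 2 * r := h1
      _ < c * r := by nlinarith
      _ ≤ ‖L (circleLoop 0 r t)‖ := h2

end Summit.SmoothPoincare4.SmoothPoincare4.Theorems.GromovRecognitionRelEnd.CrossCapLaurent
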